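import Summits.AtomisticToContinuum.BoseEinsteinCondensation.Theorems.BlockLatticeFSumFSumOccupation
import Summits.AtomisticToContinuum.BoseEinsteinCondensation.Theorems.BlockLatticeFSumSuperblock

/-!
# Super-block Cauchy–Schwarz at the OCCUPATION level (route `BlockLatticeFSum`; decomp-a2c lens-6 g22)

`Σ_j Σ_B n((u_B − u_(B+e_j))/√2) + (3/4)·Σ_c n(U_c) ≤ 6·Σ_B n(u_B)` for continuous `(n+1)`-particle
`Ψ`, where `U_c = (1/√8)·Σ_(τ∈{0,1}³) u_(c+τ)` is the normalised indicator of the super-block (side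
`2L/K`) with corner `c` — ALL `K³` corners, i.e. the 8 half-shifted double-block tilings together.
Pointwise in `Y` this is `Superblock.corner_inequality`; lifted by `cellOccupation_transfer_le`.
No definitions, no `sorry`.
-/

namespace Summit.AtomisticToContinuum.BoseEinsteinCondensation.Theses.BlockLatticeFSum.SuperblockOcc

open MeasureTheory Complex
open scoped ENNReal NNReal ComplexConjugate BigOperators
open Literature.MathematicalPhysics.QuantumManyBody.BoseGas

variable {L : ℝ} {n K : ℕ}

/-- Squared amplitude of a bond mode. -/
theorem norm_sq_modeAn_bond (B B' : Fin 3 → Fin K) {Ψ : Config (n + 1) → ℂ} (hΨ : Continuous Ψ)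
    (Y : Config n) :
    ‖modeAn L (fun x : EuclideanSpace ℝ (Fin 3) => (((Real.sqrt 2)⁻¹ : ℝ) : ℂ) * ((if (∀ i : Fin 3, ⌊(K : ℝ) * x i / L⌋ = (((B i : Fin K) : ℕ) : ℤ)) then ((((Real.sqrt ((L / (K : ℝ)) ^ 3))⁻¹ : ℝ) : ℂ)) else 0) - (if (∀ i : Fin 3, ⌊(K : ℝ) * x i / L⌋ = (((B' i : Fin K) : ℕ) : ℤ)) then ((((Real.sqrt ((L / (K : ℝ)) ^ 3))⁻¹ : ℝ) : ℂ)) else 0))) Ψ Y‖ ^ 2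
      = ‖modeAn L (fun x : EuclideanSpace ℝ (Fin 3) => if (∀ j : Fin 3, ⌊(K : ℝ) * x j / L⌋ = (((B j : Fin K) : ℕ) : ℤ)) then ((((Real.sqrt ((L / (K : ℝ)) ^ 3))⁻¹ : ℝ) : ℂ)) else 0) Ψ Y - modeAn L (fun x : EuclideanSpace ℝ (Fin 3) => if (∀ j : Fin 3, ⌊(K : ℝ) * x j / L⌋ = (((B' j : Fin K) : ℕ) : ℤ)) then ((((Real.sqrt ((L / (K : ℝ)) ^ 3))⁻¹ : ℝ) : ℂ)) else 0) Ψ Y‖ ^ 2 / 2 := by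
  rw [FSum.modeAn_bond B B' hΨ Y, norm_mul, mul_pow, Complex.norm_real,
    Real.norm_of_nonneg (inv_nonneg.2 (Real.sqrt_nonneg _)), inv_pow,
    Real.sq_sqrt (by norm_num : (0:ℝ) ≤ 2)]
  ring

/-- Measurability of a super-block mode. -/
theorem measurable_super [NeZero K] (c : Fin 3 → Fin K) : Measurable (fun x : EuclideanSpace ℝ (Fin 3) => ∑ τ : Fin 3 → Fin 2, (((Real.sqrt 8)⁻¹ : ℝ) : ℂ) * (if (∀ i : Fin 3, ⌊(K : ℝ) * x i / L⌋ = ((((c + (fun i : Fin 3 => ((τ i : ℕ) • (1 : Fin K)))) i : Fin K) : ℕ) : ℤ)) then ((((Real.sqrt ((L / (K : ℝ)) ^ 3))⁻¹ : ℝ) : ℂ)) else 0)) := by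
  refine Finset.measurable_sum _ fun τ _ => ?_
  exact measurable_const.mul (Kinematics.measurable_blockMode K L _)

/-- Amplitude of a super-block mode: `a(U_c)Ψ(Y) = (1/√8)·Σ_τ a(u_(c+τ))Ψ(Y)`. -/
theorem modeAn_super [NeZero K] (c : Fin 3 → Fin K) {Ψ : Config (n + 1) → ℂ} (hΨ : Continuous Ψ)
    (Y : Config n) :
    modeAn L (fun x : EuclideanSpace ℝ (Fin 3) => ∑ τ : Fin 3 → Fin 2, (((Real.sqrt 8)⁻¹ : ℝ) : ℂ) * (if (∀ i : Fin 3, ⌊(K : ℝ) * x i / L⌋ = ((((c + (fun i : Fin 3 => ((τ i : ℕ) • (1 : Fin K)))) i : Fin K) : ℕ) : ℤ)) then ((((Real.sqrt ((L / (K : ℝ)) ^ 3))⁻¹ : ℝ) : ℂ)) else 0)) Ψ Y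
      = (((Real.sqrt 8)⁻¹ : ℝ) : ℂ) * ∑ τ : Fin 3 → Fin 2, modeAn L (fun x : EuclideanSpace ℝ (Fin 3) => if (∀ j : Fin 3, ⌊(K : ℝ) * x j / L⌋ = ((((c + (fun i : Fin 3 => ((τ i : ℕ) • (1 : Fin K)))) j : Fin K) : ℕ) : ℤ)) then ((((Real.sqrt ((L / (K : ℝ)) ^ 3))⁻¹ : ℝ) : ℂ)) else 0) Ψ Y := by
  refine (Kinematics.modeAn_finset_sum_mode Finset.univ (fun _ => (((Real.sqrt 8)⁻¹ : ℝ) : ℂ))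
    (fun τ : Fin 3 → Fin 2 => (fun x : EuclideanSpace ℝ (Fin 3) => if (∀ j : Fin 3, ⌊(K : ℝ) * x j / L⌋ = ((((c + (fun i : Fin 3 => ((τ i : ℕ) • (1 : Fin K)))) j : Fin K) : ℕ) : ℤ)) then ((((Real.sqrt ((L / (K : ℝ)) ^ 3))⁻¹ : ℝ) : ℂ)) else 0))
    (fun τ => Kinematics.measurable_blockMode K L _) (fun τ => ⟨_, Kinematics.norm_blockMode_le K L _⟩)
    hΨ Y).trans ?_
  simp only [Complex.conj_ofReal]
  rw [← Finset.mul_sum]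

/-- Squared amplitude of a super-block mode. -/
theorem norm_sq_modeAn_super [NeZero K] (c : Fin 3 → Fin K) {Ψ : Config (n + 1) → ℂ}
    (hΨ : Continuous Ψ) (Y : Config n) :
    ‖modeAn L (fun x : EuclideanSpace ℝ (Fin 3) => ∑ τ : Fin 3 → Fin 2, (((Real.sqrt 8)⁻¹ : ℝ) : ℂ) * (if (∀ i : Fin 3, ⌊(K : ℝ) * x i / L⌋ = ((((c + (fun i : Fin 3 => ((τ i : ℕ) • (1 : Fin K)))) i : Fin K) : ℕ) : ℤ)) then ((((Real.sqrt ((L / (K : ℝ)) ^ 3))⁻¹ : ℝ) : ℂ)) else 0)) Ψ Y‖ ^ 2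
      = ‖∑ τ : Fin 3 → Fin 2, modeAn L (fun x : EuclideanSpace ℝ (Fin 3) => if (∀ j : Fin 3, ⌊(K : ℝ) * x j / L⌋ = ((((c + (fun i : Fin 3 => ((τ i : ℕ) • (1 : Fin K)))) j : Fin K) : ℕ) : ℤ)) then ((((Real.sqrt ((L / (K : ℝ)) ^ 3))⁻¹ : ℝ) : ℂ)) else 0) Ψ Y‖ ^ 2 / 8 := by
  rw [modeAn_super c hΨ Y, norm_mul, mul_pow, Complex.norm_real,
    Real.norm_of_nonneg (inv_nonneg.2 (Real.sqrt_nonneg _)), inv_pow,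
    Real.sq_sqrt (by norm_num : (0:ℝ) ≤ 8)]
  ring

/-- **SUPER-BLOCK INEQUALITY at occupation level (raw transfer form).** -/
theorem superblock_occupation_raw [NeZero K] {Ψ : Config (n + 1) → ℂ} (hΨ : Continuous Ψ) :
    ∑ a : (Fin 3 × (Fin 3 → Fin K)) ⊕ (Fin 3 → Fin K),
        ENNReal.ofReal (Sum.elim (fun _ : Fin 3 × (Fin 3 → Fin K) => (1 : ℝ))
          (fun _ : Fin 3 → Fin K => (3 / 4 : ℝ)) a)
        * cellOccupation (n + 1) L
          (Sum.elim
            (fun p : Fin 3 × (Fin 3 → Fin K) => (fun x : EuclideanSpace ℝ (Fin 3) => (((Real.sqrt 2)⁻¹ : ℝ) : ℂ) * ((if (∀ i : Fin 3, ⌊(K : ℝ) * x i / L⌋ = (((p.2 i : Fin K) : ℕ) : ℤ)) then ((((Real.sqrt ((L / (K : ℝ)) ^ 3))⁻¹ : ℝ) : ℂ)) else 0) - (if (∀ i : Fin 3, ⌊(K : ℝ) * x i / L⌋ = ((((p.2 + (Pi.single p.1 (1 : Fin K) : Fin 3 → Fin K)) i : Fin K) : ℕ) : ℤ)) then ((((Real.sqrt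 ((L / (K : ℝ)) ^ 3))⁻¹ : ℝ) : ℂ)) else 0))))
            (fun c : Fin 3 → Fin K => (fun x : EuclideanSpace ℝ (Fin 3) => ∑ τ : Fin 3 → Fin 2, (((Real.sqrt 8)⁻¹ : ℝ) : ℂ) * (if (∀ i : Fin 3, ⌊(K : ℝ) * x i / L⌋ = ((((c + (fun i : Fin 3 => ((τ i : ℕ) • (1 : Fin K)))) i : Fin K) : ℕ) : ℤ)) then ((((Real.sqrt ((L / (K : ℝ)) ^ 3))⁻¹ : ℝ) : ℂ)) else 0))) a) Ψ
      ≤ ∑ B : Fin 3 → Fin K, ENNReal.ofReal (6 : ℝ) * cellOccupation (n + 1) L (fun x : EuclideanSpace ℝ (Fin 3) => if (∀ j : Fin 3, ⌊(K : ℝ) * x j / L⌋ = (((B j : Fin K) : ℕ) : ℤ)) then ((((Real.sqrt ((L / (K : ℝ)) ^ 3))⁻¹ : ℝ) : ℂ)) else 0) Ψ := by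
  classical
  refine Kinematics.cellOccupation_transfer_le Finset.univ Finset.univ _ _
    (by rintro (p | c) _ <;> norm_num) (fun _ _ => by norm_num) _ _
    (by
      rintro (p | c)
      · exact FSum.measurable_bond _ _
      · exact measurable_super c)
    (fun B => Kinematics.measurable_blockMode K L B) hΨ ?_
  intro Y _
  rw [Fintype.sum_sum_type, Fintype.sum_prod_type]
  simp only [Sum.elim_inl, Sum.elim_inr, one_mul]
  have hb : ∀ (j : Fin 3) (B : Fin 3 → Fin K),
      ‖modeAn L (fun x : EuclideanSpace ℝ (Fin 3) => (((Real.sqrt 2)⁻¹ : ℝ) : ℂ) * ((if (∀ i : Fin 3, ⌊(K : ℝ) * x i / L⌋ = (((B i : Fin K) : ℕ) : ℤ)) then ((((Real.sqrt ((L / (K : ℝ)) ^ 3))⁻¹ : ℝ) : ℂ)) else 0) - (if (∀ i : Fin 3, ⌊(K : ℝ) * x i / L⌋ = ((((B + (Pi.single j (1 : Fin K) : Fin 3 → Fin K)) i : Fin K) : ℕ) : ℤ)) then ((((Real.sqrt ((L / (K : ℝ)) ^ 3))⁻¹ : ℝ) : ℂ)) else 0))) Ψ Y‖ ^ 2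
        = ‖modeAn L (fun x : EuclideanSpace ℝ (Fin 3) => if (∀ j : Fin 3, ⌊(K : ℝ) * x j / L⌋ = (((B j : Fin K) : ℕ) : ℤ)) then ((((Real.sqrt ((L / (K : ℝ)) ^ 3))⁻¹ : ℝ) : ℂ)) else 0) Ψ Y - modeAn L (fun x : EuclideanSpace ℝ (Fin 3) => if (∀ i : Fin 3, ⌊(K : ℝ) * x i / L⌋ = ((((B + (Pi.single j (1 : Fin K) : Fin 3 → Fin K)) i : Fin K) : ℕ) : ℤ)) then ((((Real.sqrt ((L / (K : ℝ)) ^ 3))⁻¹ : ℝ) : ℂ)) else 0) Ψ Y‖ ^ 2 / 2 :=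
    fun j B => norm_sq_modeAn_bond B _ hΨ Y
  have hs : ∀ c : Fin 3 → Fin K, (3 / 4 : ℝ) * ‖modeAn L (fun x : EuclideanSpace ℝ (Fin 3) => ∑ τ : Fin 3 → Fin 2, (((Real.sqrt 8)⁻¹ : ℝ) : ℂ) * (if (∀ i : Fin 3, ⌊(K : ℝ) * x i / L⌋ = ((((c + (fun i : Fin 3 => ((τ i : ℕ) • (1 : Fin K)))) i : Fin K) : ℕ) : ℤ)) then ((((Real.sqrt ((L / (K : ℝ)) ^ 3))⁻¹ : ℝ) : ℂ)) else 0)) Ψ Y‖ ^ 2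
        = (3 / 4 : ℝ) * (‖∑ τ : Fin 3 → Fin 2, modeAn L (fun x : EuclideanSpace ℝ (Fin 3) => if (∀ j : Fin 3, ⌊(K : ℝ) * x j / L⌋ = ((((c + (fun i : Fin 3 => ((τ i : ℕ) • (1 : Fin K)))) j : Fin K) : ℕ) : ℤ)) then ((((Real.sqrt ((L / (K : ℝ)) ^ 3))⁻¹ : ℝ) : ℂ)) else 0) Ψ Y‖ ^ 2 / 8) :=
    fun c => by rw [norm_sq_modeAn_super c hΨ Y]
  rw [Finset.sum_congr rfl fun j _ => Finset.sum_congr rfl fun B _ => hb j B,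
    Finset.sum_congr rfl fun c _ => hs c, ← Finset.mul_sum, ← Finset.mul_sum]
  exact Superblock.corner_inequality (E := ℂ) (fun B : Fin 3 → Fin K => modeAn L (fun x : EuclideanSpace ℝ (Fin 3) => if (∀ j : Fin 3, ⌊(K : ℝ) * x j / L⌋ = (((B j : Fin K) : ℕ) : ℤ)) then ((((Real.sqrt ((L / (K : ℝ)) ^ 3))⁻¹ : ℝ) : ℂ)) else 0) Ψ Y)

/-- **SUPER-BLOCK INEQUALITY at occupation level:**
`Σ_j Σ_B n((u_B − u_(B+e_j))/√2) + (3/4)·Σ_c n(U_c) ≤ 6·Σ_B n(u_B)`. -/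
theorem superblock_occupation [NeZero K] {Ψ : Config (n + 1) → ℂ} (hΨ : Continuous Ψ) :
    ∑ j : Fin 3, ∑ B : Fin 3 → Fin K, cellOccupation (n + 1) L (fun x : EuclideanSpace ℝ (Fin 3) => (((Real.sqrt 2)⁻¹ : ℝ) : ℂ) * ((if (∀ i : Fin 3, ⌊(K : ℝ) * x i / L⌋ = (((B i : Fin K) : ℕ) : ℤ)) then ((((Real.sqrt ((L / (K : ℝ)) ^ 3))⁻¹ : ℝ) : ℂ)) else 0) - (if (∀ i : Fin 3, ⌊(K : ℝ) * x i / L⌋ = ((((B + (Pi.single j (1 : Fin K) : Fin 3 → Fin K)) i : Fin K) : ℕ) : ℤ)) then ((((Real.sqrt ((L / (K : ℝ)) ^ 3))⁻¹ : ℝ) : ℂ)) else 0))) Ψ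
      + ENNReal.ofReal (3 / 4) * ∑ c : Fin 3 → Fin K, cellOccupation (n + 1) L (fun x : EuclideanSpace ℝ (Fin 3) => ∑ τ : Fin 3 → Fin 2, (((Real.sqrt 8)⁻¹ : ℝ) : ℂ) * (if (∀ i : Fin 3, ⌊(K : ℝ) * x i / L⌋ = ((((c + (fun i : Fin 3 => ((τ i : ℕ) • (1 : Fin K)))) i : Fin K) : ℕ) : ℤ)) then ((((Real.sqrt ((L / (K : ℝ)) ^ 3))⁻¹ : ℝ) : ℂ)) else 0)) Ψ
      ≤ ENNReal.ofReal 6 * ∑ B : Fin 3 → Fin K, cellOccupation (n + 1) L (fun x : EuclideanSpace ℝ (Fin 3) => if (∀ j : Fin 3, ⌊(K : ℝ) * x j / L⌋ = (((B j : Fin K) : ℕ) : ℤ)) then ((((Real.sqrt ((L / (K : ℝ)) ^ 3))⁻¹ : ℝ) : ℂ)) else 0) Ψ := by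
  have h := superblock_occupation_raw (L := L) (K := K) hΨ
  rw [Fintype.sum_sum_type, Fintype.sum_prod_type] at h
  simp only [Sum.elim_inl, Sum.elim_inr, ENNReal.ofReal_one, one_mul] at h
  rw [← Finset.mul_sum, ← Finset.mul_sum] at h
  exact h

end Summit.AtomisticToContinuum.BoseEinsteinCondensation.Theses.BlockLatticeFSum.SuperblockOcc
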